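import Mathlib
import HarnessLib
import Summits.NavierStokesRegularity.NavierStokesRegularity.Theorems.PoloidalWindowDoorLrcModEntireSheetFlattenTools

/-!
# Route `PoloidalWindowDoor`, item `LrcModEntire` (stmt-NavierStokesRegularity-20428), cell (Q4-sonic) of the (TH) column —
# THE TRANSPORT LAW ON A CHARACTERISTIC SHEET: `d′(z)·(∂_ν²θ)² is constant along the parallel web`

Cell ns-regularity-ideate, LEAD-lineage seat ns-poloidal-K2-p3 g16 (`--supports stmt-NavierStokesRegularity-20428`; memo `Cruxes/LrcModEntire/T2B-g16.md` §5,
PICKED.md v10 «disprover-wanted: stub_Q4sonic»).  Companion of `…SheetFlatten.fderiv_apply_eq_zero_on_slab` (the NON-characteristic case, Cauchy–Kovalevskaya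
uniqueness).  Setting: `θ : ℝ³ → ℝ` smooth with the slice law `∂₂²θ = −μ(x₂)Δₕθ` on the slab `{x₂ ∈ I}`, a horizontal unit vector `e`, the parallel web
`x = s·e + d(z)·Je + z·e₂` of critical points of `θ` in the direction `Je`, and the sheet CHARACTERISTIC: `Q(z) = d′(z)² + μ(z) = 0` on `I`.
In the sheared flattened coordinates `H(s,n,z) = θ(s·e + (n + d(z))·Je + z·e₂)` the slice law reads
`H_zz − 2d′H_nz − d″H_n + Q H_nn + μ H_ss = 0` (`…SheetFlattenTools.sheetOp_shear_eq_zero`); the same equation holds for `H_n`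
(`…SheetCauchyUniqueness.sheetOp_pdN_eq_zero`), and on the sheet `{n = 0}` (where `H_n = 0`, hence `H_nzz = H_nss = 0`) it collapses, for `Q = 0`, to the
TRANSPORT LAW `2d′(z)·∂_z a + d″(z)·a = 0` for `a(s,z) = H_nn(s,0,z) = D²θ(web point)[Je][Je]`, i.e. `∂_z (d′ a²) = 0`:

* `transport_on_characteristic_sheet` — `HasDerivAt (z ↦ d′(z)·(D²θ(s·e + d(z)·Je + z·e₂)[Je][Je])²) 0 z` for every `s` and `z ∈ I`.

Use (cell (Q4-sonic), straight branch): with `μ(−1,0) = 0` one has `d′(0) = 0`, so `d′a² ≡ 0` on the window; strict concavity (`a < 0`) forces `d′ ≡ 0`,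
`μ ≡ −d′² ≡ 0`, and `…VerticalShearGerm.eq_zero_of_verticalShear_eq_zero_on_open` ends.

WHAT THIS IS NOT: not a claim about Navier–Stokes regularity; class-free calculus (bears_on LADDER-NS N0 via item 20428).
-/

noncomputable section

set_option linter.dupNamespace false
set_option linter.unusedVariables false

namespace Summit.NavierStokesRegularity.NavierStokesRegularity.Theorems.PoloidalWindowDoorLrcModEntireSheetTransport

open Set Function Filter Topology Metric
open scoped ContDiff
open Summit.NavierStokesRegularity.NavierStokesRegularity.Theorems.PoloidalWindowDoorLrcModEntireSheetCauchyUniqueness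
open Summit.NavierStokesRegularity.NavierStokesRegularity.Theorems.PoloidalWindowDoorLrcModEntireSheetFlattenTools

/-- The derivative along the height of a function restricted to the sheet is its `∂_z`. -/
theorem hasDerivAt_sheet_line {I : Set ℝ} (hI : IsOpen I) {K : ℝ × ℝ × ℝ → ℝ} (hK : ContDiffOn ℝ ∞ K (slab I))
    (s : ℝ) {z : ℝ} (hz : z ∈ I) : HasDerivAt (fun z' : ℝ => K (s, 0, z')) (pd eZ K (s, 0, z)) z := by
  have hp : ((s, 0, z) : ℝ × ℝ × ℝ) ∈ slab I := hz
  have hd : HasFDerivAt K (fderiv ℝ K (s, 0, z)) ((fun z' : ℝ => ((s, 0, z') : ℝ × ℝ × ℝ)) z) :=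
    (differentiableAt_of_slab hI hK hp).hasFDerivAt
  have hl : HasDerivAt (fun z' : ℝ => ((s, 0, z') : ℝ × ℝ × ℝ)) eZ z := by
    have h : HasDerivAt (fun z' : ℝ => ((s, 0, z') : ℝ × ℝ × ℝ)) ((0 : ℝ), (0 : ℝ), (1 : ℝ)) z :=
      (hasDerivAt_const z s).prodMk ((hasDerivAt_const z (0 : ℝ)).prodMk (hasDerivAt_id z))
    simpa [eZ] using h
  exact hd.comp_hasDerivAt z hl

/-- **THE TRANSPORT LAW ON A CHARACTERISTIC SHEET.**  `θ` smooth with the slice law `∂₂²θ = −μ(x₂)Δₕθ` (coordinate-nested form) on the slab `{x₂ ∈ I}`,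
`e` a horizontal unit vector, `d` smooth on `I`, the web points `s·e + d(z)·Je + z·e₂` critical for `θ` in the direction `Je`, and the sheet characteristic,
`d′(z)² + μ(z) = 0` on `I`: then `z ↦ d′(z)·(D²θ(s·e + d(z)·Je + z·e₂)[Je][Je])²` has derivative `0` at every `z ∈ I`. -/
theorem transport_on_characteristic_sheet {θ : EuclideanSpace ℝ (Fin 3) → ℝ} (hθ : ContDiff ℝ ∞ θ)
    {I : Set ℝ} (hI : IsOpen I) {μ d : ℝ → ℝ} (hμ : ∀ z ∈ I, DifferentiableAt ℝ μ z) (hd : ContDiffOn ℝ ∞ d I)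
    {e : EuclideanSpace ℝ (Fin 3)} (he2 : e 2 = 0) (hunit : e 0 ^ 2 + e 1 ^ 2 = 1)
    (hlaw : ∀ x : EuclideanSpace ℝ (Fin 3), x 2 ∈ I →
      fderiv ℝ (fun y => fderiv ℝ θ y (EuclideanSpace.single 2 (1 : ℝ))) x (EuclideanSpace.single 2 (1 : ℝ)) =
        -μ (x 2) * (fderiv ℝ (fun y => fderiv ℝ θ y (EuclideanSpace.single 0 (1 : ℝ))) x (EuclideanSpace.single 0 (1 : ℝ)) +
          fderiv ℝ (fun y => fderiv ℝ θ y (EuclideanSpace.single 1 (1 : ℝ))) x (EuclideanSpace.single 1 (1 : ℝ))))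
    (hweb : ∀ s : ℝ, ∀ z ∈ I, fderiv ℝ θ (s • e + d z • Jvec e + z • e2) (Jvec e) = 0)
    (hQ0 : ∀ z ∈ I, deriv d z ^ 2 + μ z = 0) (s : ℝ) {z : ℝ} (hz : z ∈ I) :
    HasDerivAt (fun z' : ℝ => deriv d z' * (fderiv ℝ (fderiv ℝ θ) (s • e + d z' • Jvec e + z' • e2) (Jvec e) (Jvec e)) ^ 2) 0 z := by
  -- smoothness and the flattened field
  have hθ2 : ContDiff ℝ 2 θ := hθ.of_le (by norm_cast)
  have hθd : Differentiable ℝ θ := hθ.differentiable (by simp)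
  set Θ : ℝ × ℝ × ℝ → ℝ := fun q => θ (frameCLM e q) with hΘ
  have hΘs : ContDiff ℝ ∞ Θ := hθ.comp (frameCLM e).contDiff
  have hΘon : ContDiffOn ℝ ∞ Θ (slab I) := hΘs.contDiffOn
  have hΘpde : ∀ p ∈ slab I, sheetOp (fun _ => 0) (fun _ => 0) μ μ Θ p = 0 :=
    sheetOp_frame_eq_zero hθ2 hlaw he2 hunit
  -- the sheared field and its equation
  set H : ℝ × ℝ × ℝ → ℝ := fun q => Θ (shear d q) with hH
  have hHpde := sheetOp_shear_eq_zero hI hΘs hΘpde hd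
  have hHs : ContDiffOn ℝ ∞ H (slab I) := contDiffOn_shear hI hΘs hd
  -- derivatives of `d`
  have hdd : ∀ z ∈ I, DifferentiableAt ℝ d z := fun z hz =>
    (hd.contDiffAt (hI.mem_nhds hz)).differentiableAt (by simp)
  have hd1 : ContDiffOn ℝ ∞ (deriv d) I := hd.deriv_of_isOpen hI (m := ∞) (by simp)
  have hdd1 : ∀ z ∈ I, DifferentiableAt ℝ (deriv d) z := fun z hz =>
    (hd1.contDiffAt (hI.mem_nhds hz)).differentiableAt (by simp)
  have hd2 : ContDiffOn ℝ ∞ (deriv (deriv d)) I := hd1.deriv_of_isOpen hI (m := ∞) (by simp)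
  have hdd2 : ∀ z ∈ I, DifferentiableAt ℝ (deriv (deriv d)) z := fun z hz =>
    (hd2.contDiffAt (hI.mem_nhds hz)).differentiableAt (by simp)
  have hA : ∀ z ∈ I, DifferentiableAt ℝ (fun z => -2 * deriv d z) z := fun z hz => (hdd1 z hz).const_mul _
  have hB : ∀ z ∈ I, DifferentiableAt ℝ (fun z => -(deriv (deriv d) z)) z := fun z hz => (hdd2 z hz).neg
  have hQd : ∀ z ∈ I, DifferentiableAt ℝ (fun z => deriv d z ^ 2 + μ z) z := fun z hz =>
    ((hdd1 z hz).pow 2).add (hμ z hz)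
  -- the equation for `K₂ = ∂_n H`
  set K₂ : ℝ × ℝ × ℝ → ℝ := pd eN H with hK₂
  have hK₂s : ContDiffOn ℝ ∞ K₂ (slab I) := contDiffOn_pd hI hHs eN
  have hK₂pde := sheetOp_pdN_eq_zero hI hA hB hQd hμ hHs hHpde
  -- geometry of the sheet
  have hshear0 : ∀ s z : ℝ, shear d (s, 0, z) = (s, d z, z) := fun s z => by simp [shear]
  have hframe : ∀ s m z : ℝ, frameCLM e (s, m, z) = s • e + m • Jvec e + z • e2 := fun s m z => by
    rw [frameCLM_apply]
  -- the Cauchy datum `K₂ = 0` on the sheet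
  have hN : ∀ s : ℝ, ∀ z ∈ I, K₂ (s, 0, z) = 0 := by
    intro s z hz
    have hp : ((s, 0, z) : ℝ × ℝ × ℝ) ∈ slab I := hz
    rw [hK₂, hH, pd_shear_eN hI hΘon hp (hdd z hz), hshear0, hΘ, pd_comp_frame hθd e eN, frameCLM_eN, hframe]
    exact hweb s z hz
  -- tangential derivatives of `K₂` vanish on the sheet
  have hZ : ∀ s : ℝ, ∀ z ∈ I, pd eZ K₂ (s, 0, z) = 0 := fun s z hz =>
    pd_eq_zero_of_vanish_on_sheet hI hN hz (differentiableAt_of_slab hI hK₂s (sheet_mem_slab s hz)) (v := eZ) rfl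
  have hS : ∀ s : ℝ, ∀ z ∈ I, pd eS K₂ (s, 0, z) = 0 := fun s z hz =>
    pd_eq_zero_of_vanish_on_sheet hI hN hz (differentiableAt_of_slab hI hK₂s (sheet_mem_slab s hz)) (v := eS) rfl
  have hZZ : pd eZ (pd eZ K₂) (s, 0, z) = 0 :=
    pd_eq_zero_of_vanish_on_sheet hI hZ hz (differentiableAt_of_slab hI (contDiffOn_pd hI hK₂s eZ) (sheet_mem_slab s hz))
      (v := eZ) rfl
  have hSS : pd eS (pd eS K₂) (s, 0, z) = 0 :=
    pd_eq_zero_of_vanish_on_sheet hI hS hz (differentiableAt_of_slab hI (contDiffOn_pd hI hK₂s eS) (sheet_mem_slab s hz))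
      (v := eS) rfl
  -- the transport law at `(s, 0, z)`
  have htr : (-2 * deriv d z) * pd eZ (pd eN K₂) (s, 0, z) + (-(deriv (deriv d) z)) * pd eN K₂ (s, 0, z) = 0 := by
    have h := hK₂pde (s, 0, z) (sheet_mem_slab s hz)
    unfold sheetOp at h
    simp only at h
    rw [hZZ, hSS, hQ0 z hz] at h
    linarith
  -- `a(z') = ∂_n K₂ (s,0,z')` and its derivative along the sheet
  have hNs : ContDiffOn ℝ ∞ (pd eN K₂) (slab I) := contDiffOn_pd hI hK₂s eN
  have ha : HasDerivAt (fun z' : ℝ => pd eN K₂ (s, 0, z')) (pd eZ (pd eN K₂) (s, 0, z)) z := hasDerivAt_sheet_line hI hNs s hz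
  have hprod : HasDerivAt (fun z' : ℝ => deriv d z' * (pd eN K₂ (s, 0, z') * pd eN K₂ (s, 0, z')))
      (deriv (deriv d) z * (pd eN K₂ (s, 0, z) * pd eN K₂ (s, 0, z)) +
        deriv d z * (pd eZ (pd eN K₂) (s, 0, z) * pd eN K₂ (s, 0, z) + pd eN K₂ (s, 0, z) * pd eZ (pd eN K₂) (s, 0, z))) z :=
    (hdd1 z hz).hasDerivAt.mul (ha.mul ha)
  have hzero : deriv (deriv d) z * (pd eN K₂ (s, 0, z) * pd eN K₂ (s, 0, z)) +
      deriv d z * (pd eZ (pd eN K₂) (s, 0, z) * pd eN K₂ (s, 0, z) + pd eN K₂ (s, 0, z) * pd eZ (pd eN K₂) (s, 0, z)) = 0 := by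
    linear_combination (-(pd eN K₂ (s, 0, z))) * htr
  have hmain : HasDerivAt (fun z' : ℝ => deriv d z' * (pd eN K₂ (s, 0, z') * pd eN K₂ (s, 0, z'))) 0 z :=
    hprod.congr_deriv hzero
  -- identify `a(z')` with `D²θ(web point)[Je][Je]` near `z`
  have hident : ∀ z' ∈ I, pd eN K₂ (s, 0, z') = fderiv ℝ (fderiv ℝ θ) (s • e + d z' • Jvec e + z' • e2) (Jvec e) (Jvec e) := by
    intro z' hz'
    have hp : ((s, 0, z') : ℝ × ℝ × ℝ) ∈ slab I := hz'
    have hNΘs : ContDiffOn ℝ ∞ (pd eN Θ) (slab I) := contDiffOn_pd hI hΘon eN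
    have heq : ∀ q ∈ slab I, K₂ q = pd eN Θ (shear d q) := fun q hq => by
      rw [hK₂, hH, pd_shear_eN hI hΘon hq (hdd q.2.2 hq)]
    rw [pd_congr_on_slab hI eN heq hp, pd_shear_eN hI hNΘs hp (hdd z' hz'), hshear0, hΘ, pd_pd_comp_frame hθ2 e eN eN,
      frameCLM_eN, hframe, nested_eq_fderiv_fderiv hθ2]
  refine hmain.congr_of_eventuallyEq ?_
  filter_upwards [hI.mem_nhds hz] with z' hz'
  rw [← hident z' hz', sq]

end Summit.NavierStokesRegularity.NavierStokesRegularity.Theorems.PoloidalWindowDoorLrcModEntireSheetTransport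

end
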